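import Summits.Langlands.Langlands.Theses.SkinnerWilesDefectOne

/-!
# `ProModularOfEisensteinSeed` (stmt-Langlands-14718) — the two formal edges of the glue item

Route `SkinnerWilesDefectOne`, support item stmt-Langlands-14718:
`ProModularOfEisensteinSeed := EisensteinProModularSeed → ReducibleOrdinaryProModular`
("Skinner–Wiles' Main Theorem at defect one GIVEN their step (II)": the seed crux stmt-Langlands-12920
implies the engine crux stmt-Langlands-12919).

This helper file records, kernel-checked, where the item sits in the route's implication graph — it does
NOT close the item (its mathematical content, Skinner–Wiles steps (I)+(III) over `Λ_F = 𝒪[[T₁,T₂,Y₁,Y₂]]`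
with `l₀ = 1`, has no theorem in print and no infrastructure in the tree; see the item's notes):

* `proModularOfEisensteinSeed_of_engine` — the glue is a WEAKENING of the engine crux: any proof of
  `ReducibleOrdinaryProModular` (stmt-Langlands-12919, attacked directly by the crux lines under
  `Cruxes/ReducibleOrdinaryProModular/`) closes this item in one line;
* `reducibleOrdinaryProModular_of_seed` — the planner's intended use (route header, GLUE SEED → ENGINE):
  seed + glue give the engine, i.e. the `closes` hypothesis `h₁`.

Both are pure logic over the route declarations; no statement of the route is assumed true. [folklore]
-/

set_option linter.dupNamespace false -- project-wide option (lakefile weak.linter.dupNamespace); `Summit.Langlands.Langlands` is the mandated namespace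

namespace Summit.Langlands.Langlands.Theorems

open Summit.Langlands.Langlands.Theses.SkinnerWilesDefectOne

/-- **The glue item is implied by the engine crux.** `ReducibleOrdinaryProModular → ProModularOfEisensteinSeed`:
an implication with conclusion the engine follows from the engine itself (the seed hypothesis is discarded).
Hence stmt-Langlands-14718 closes the moment stmt-Langlands-12919 does. [folklore] -/
theorem proModularOfEisensteinSeed_of_engine (h : ReducibleOrdinaryProModular) :
    ProModularOfEisensteinSeed :=
  fun _ => h

/-- The glue item and the engine crux are EQUIVALENT once the seed holds: given
`EisensteinProModularSeed`, `ProModularOfEisensteinSeed ↔ ReducibleOrdinaryProModular`. So, conditionally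
on the entrance crux, this item carries exactly the engine's content. [folklore] -/
theorem proModularOfEisensteinSeed_iff_engine_of_seed (hS : EisensteinProModularSeed) :
    ProModularOfEisensteinSeed ↔ ReducibleOrdinaryProModular :=
  ⟨fun hG => hG hS, proModularOfEisensteinSeed_of_engine⟩

/-- **Seed + glue ⇒ engine** (modus ponens, the route's intended composition): from the entrance crux
`EisensteinProModularSeed` (stmt-Langlands-12920) and this glue item one gets the engine crux
`ReducibleOrdinaryProModular` (stmt-Langlands-12919), the first hypothesis of the deciding theorem `closes`.
[folklore] -/
theorem reducibleOrdinaryProModular_of_seed (hS : EisensteinProModularSeed)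
    (hG : ProModularOfEisensteinSeed) : ReducibleOrdinaryProModular :=
  (proModularOfEisensteinSeed_iff_engine_of_seed hS).mp hG

end Summit.Langlands.Langlands.Theorems
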